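import Summits.NavierStokesRegularity.FluidComputer.GateBudgetColdHalfSharp
import Summits.NavierStokesRegularity.FluidComputer.GateBudgetLadderClock
import HarnessLib

/-!
# GateBudget part 88 — the sharp ladder: the climb with the sharp rung loss (§256–§257)

Cell `pub-fluidc`, blueprint seat bp1 (gen 37, successor item (a) of SPEC-INPUT-bp1 §BO(4));
namespace `Summit.NavierStokesRegularity.FluidComputer.GateBudget`, headline member
`RotorKnob.rotorCircuit K K¹⁰ ε ρ` of the two-scale family from `delayInit` (5.6), `K ≥ 16`, on
the lattice window `200ε/K²⁰ ≤ ρ² ≤ 2ε/K¹⁰`, `ε² ≤ 1/(6K²⁰)`, `ε = kK¹⁰ρ²`; modes `0 = a`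
(carrier), `1 = b` (clock), `2 = c` (trigger), `3 = d` (transfer), `4 = ã` (output).
HONEST FRAMING: a low prior, high value-of-information experiment on Tao's machine paradigm;
NOT a claim that NS blows up.

WHAT. Part 85 §249 climbs the clean misfire ladder charging the clock `λ = 43/K⁹ + 242 log
K/K¹⁰` per rung, the `43/K⁹` being the bookkeeping of part 57's carrier band at transfer level
`|d| ≤ 1`. Part 87 §255 `knob_cold_half_sharp` relights at `θ' ≥ θ₁ - 37(|d(T')| + 4/K⁹)/K⁹`
(or clipped into `[1.39999, 1.41422]`), and on the ladder `|d(T')| ≤ |d(r)| + ι ≤ D + ι` (part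
82 §239, part 81 §238). §257 `knob_ladder_climb_sharp` is therefore part 85 §249 line by line
with the clock charged, per rung, any real `L ≥ 242 log K/K¹⁰ + 37(D + ι + 4/K⁹)/K⁹` (`ι = (2k +
3)/(5K⁹)`): anchor `r₀ ≥ 0` in normal form, `5/4 + (N - 1)L ≤ θ₀ ≤ 29/20`, window `(N - 1)L ≤
0.14999`, the three dominating reals `D, U, S` of part 85 and the budget `P₁ + s′ + (N - 1)S ≤
1/50`; conclusion: for every `1 ≤ n ≤ N` a normal-form ignition `rₙ ≥ r₀ + (n - 1)` with `5/4 +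
(N - n)L ≤ θₙ ≤ 29/20`, `P(rₙ) ≤ P₁ + (n - 1)S`, `A₀ + (n - 1)/K⁹ ≤ ã(rₙ)` and part 81 §238's
transfer invariants; §257 `knob_ladder_sharp` reads them out uniformly in `n` (`P ≤ 1/50`, `ã ≤
0.1415`, `|d| ≤ D`). §256 `sharp_clock_signs`: `0 ≤ 242 log K/K¹⁰ ≤ 10⁻⁶`, `0 ≤ L`.
NUMBERS (part 89 instantiates). At part 83's `D = 7/K⁴` (`1 ≤ k ≤ K²`, `ι ≤ 1/K⁴`) the cold
term is `37(D + ι + 4/K⁹)/K⁹ ≤ 444/K¹³ ≤ 0.0068/K⁹` and `L ≤ 42/K⁹` (`242 log K/K ≤ 41.95` from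
`log K/K ≤ log 16/16`): the clock window admits every `N - 1 ≤ 3.428·10⁻³K⁹` uniformly in `K ≥
16` (`×2.02` part 86's `1.694·10⁻³K⁹`, `×6.8` part 83's `5.03·10⁻⁴K⁹`), and in truth `N - 1 ≤
0.144K¹⁰/(242 log K + 0.11)`, which grows like `K/log K` against `K⁹`: the PAIR window
`0.0199K⁹/(1.1 + k²/10)` of part 86 is the smaller one for `k ≥ 7` at every `K ≥ 16` and for
`k ≤ 6` from a threshold on (`K ≥ 138` at `k = 1`, `≥ 104` at `k = 2`, `≥ 22` at `k = 6`) — there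
the clean dud horizon is PAIR-limited, `≈ 0.0166K⁹` at `k = 1`, within `8.5×` of part 72's
forced ceiling `0.1415K⁹ + 1`.
HOW. §257 is part 85 §249 with part 87 §255 in place of part 84 §247 and the window arithmetic
`θ' ≥ θ₁ - 37(|d(T')| + 4/K⁹)/K⁹ ≥ θ - 242 log K/K¹⁰ - 37(D + ι + 4/K⁹)/K⁹ ≥ θ - L`; pulse half,
P-slip, exit budget, pair slip and the three ledger invariants are untouched.
HONEST LIMITS. (i) `L` is bookkeeping still: the true relight ratio drifts UP and clips at
`√(2(1 - P₀))` (part 84 header (ii)); the remaining per-rung charge is the pulse's `242 log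
K/K¹⁰` (part 61's radius Lipschitz bound × part 80's fine pulse length), itself crude (the
change is odd about mid-pulse to leading order); (ii) `A₀, D₀, P₁, D, U, S, L` free under four
explicit dominations; (iii) existence per rung, no uniqueness; (iv) the anchor's standing
reserve `s′` is still paid once; (v) nothing about Navier–Stokes.
[cite: Tao2016AveragedNS, §5.5 Theorem 5.3, (5.5), (5.6), (b-eq), (c-eq), (d-eq), (ta-eq),
(energy-con), (est)]
-/

noncomputable section

namespace Summit.NavierStokesRegularity.FluidComputer.GateBudget

open Real Set Filter Topology
open Literature.Analysis.FluidPDE.Tao2016AveragedNS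

variable {K ε ρ : ℝ} {X : ℝ → Fin 5 → ℝ} {C : ℝ → ℝ}

/-! ## §256 Signs and size of the sharp rung loss -/

/-- §256 SIGNS (`K ≥ 16`, `0 ≤ D`, `0 ≤ ι`): `0 ≤ 242 log K/K¹⁰ ≤ 10⁻⁶`, `0 ≤ 37(D + ι +
4/K⁹)/K⁹`, and every `L ≥ 242 log K/K¹⁰ + 37(D + ι + 4/K⁹)/K⁹` is `≥ 0`. [folklore] -/
theorem sharp_clock_signs (hK : 16 ≤ K) {D ι L : ℝ} (hD : 0 ≤ D) (hι : 0 ≤ ι)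
    (hL : 242 * log K / K ^ 10 + 37 * (D + ι + 4 / K ^ 9) / K ^ 9 ≤ L) :
    0 ≤ 242 * log K / K ^ 10 ∧ 242 * log K / K ^ 10 ≤ 1 / 10 ^ 6 ∧
      0 ≤ 37 * (D + ι + 4 / K ^ 9) / K ^ 9 ∧ 0 ≤ L := by
  have hK0 : (0 : ℝ) < K := by linarith
  have hK9 : (0 : ℝ) < K ^ 9 := by positivity
  have hK10 : (0 : ℝ) < K ^ 10 := by positivity
  obtain ⟨-, hfine6, -⟩ := clock_numerics hK
  have hlogK : 0 ≤ log K := Real.log_nonneg (by linarith)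
  have h1 : 0 ≤ 242 * log K / K ^ 10 := div_nonneg (mul_nonneg (by norm_num) hlogK) hK10.le
  have h4 : (0 : ℝ) ≤ 4 / K ^ 9 := by positivity
  have h2 : 0 ≤ 37 * (D + ι + 4 / K ^ 9) / K ^ 9 :=
    div_nonneg (mul_nonneg (by norm_num) (by linarith only [hD, hι, h4])) hK9.le
  exact ⟨h1, hfine6, h2, by linarith only [h1, h2, hL]⟩

/-! ## §257 The sharp climb -/

/-- §257 **THE SHARP CLIMB** (headline member from `delayInit` with a trigger primitive `C`, `K
≥ 16`, `0 < ε`, `ε² ≤ 1/(6K²⁰)`, `0 < ρ`, `200ε/K²⁰ ≤ ρ²`, `K¹⁰ρ² ≤ 2ε`, `ε = kK¹⁰ρ²`).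
With `J = ((61/12)k + 2/3)/K¹⁰ + 3/K⁹`, `ι = (2k + 3)/(5K⁹)`: ASSUME an anchor `r₀ ≥ 0` in
normal form (`b(r₀) = θ₀ε`, `c(r₀) = ρ²/K⁹`, `P(r₀) ≤ P₁`, `0 ≤ A₀ ≤ ã(r₀)`, `|d(r₀)| ≤ D₀`),
reals `D ≥ D₀ + (1 + (10/9)K⁴)J`, `U ≥ 7/2 + k²/3 + (2 log k + 520 log K)D²`, `S ≥ (0.2829 +
U/K⁹)U/K⁹ + (2D + ι)ι + 6(D + ι + 3/K⁹)/K⁹`, THE SHARP RUNG LOSS `L ≥ 242 log K/K¹⁰ + 37(D + ι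
+ 4/K⁹)/K⁹`, the clock hypotheses `5/4 + (N - 1)L ≤ θ₀ ≤ 29/20`, `(N - 1)L ≤ 0.14999`, and the
budget `P₁ + s′ + (N - 1)S ≤ 1/50` (`s′` = part 66's slip, once). THEN for every `1 ≤ n ≤ N`
there is a normal-form ignition `rₙ ≥ r₀ + (n - 1)` with `5/4 + (N - n)L ≤ θₙ ≤ 29/20`, `P(rₙ)
≤ P₁ + (n - 1)S`, `A₀ + (n - 1)/K⁹ ≤ ã(rₙ)` and part 81 §238's two transfer invariants.
[derived: part 84 §246, part 87 §255, part 82 §239, part 81 §237/§238, part 85 §249] -/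
theorem knob_ladder_climb_sharp
    (hX : ∀ t, HasDerivAt X (RotorKnob.rotorCircuit K (K ^ 10) ε ρ (X t)) t)
    (h0 : X 0 = delayInit) (hC : ∀ t, HasDerivAt C (X t 2) t) (hK : 16 ≤ K)
    (hε : 0 < ε) (hεK : ε ^ 2 ≤ 1 / (6 * K ^ 20)) (hρ : 0 < ρ)
    (hlo : 200 * ε / K ^ 20 ≤ ρ ^ 2) (hhi : K ^ 10 * ρ ^ 2 ≤ 2 * ε) (k : ℕ)
    (hk : ε = k * K ^ 10 * ρ ^ 2) {r₀ θ₀ P₁ A₀ D₀ D U S L : ℝ} {N : ℕ} (hr₀ : 0 ≤ r₀)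
    (hb₀ : X r₀ 1 = θ₀ * ε) (hc₀ : X r₀ 2 = ρ ^ 2 / K ^ 9) (hP₁ : X r₀ 3 ^ 2 + X r₀ 4 ^ 2 ≤ P₁)
    (hθ₀lo : 5 / 4 + ((N : ℝ) - 1) * L ≤ θ₀)
    (hθ₀hi : θ₀ ≤ 29 / 20)
    (hNθ : ((N : ℝ) - 1) * L ≤ 14999 / 100000)
    (hA0 : 0 ≤ A₀) (hA₀ : A₀ ≤ X r₀ 4) (hD₀ : |X r₀ 3| ≤ D₀)
    (hD : D₀ + (1 + 10 / 9 * K ^ 4) * ((61 / 12 * k + 2 / 3) / K ^ 10 + 3 / K ^ 9) ≤ D)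
    (hU : 7 / 2 + k ^ 2 / 3 + (2 * log k + 520 * log K) * D ^ 2 ≤ U)
    (hS : (2829 / 10000 + U / K ^ 9) * (U / K ^ 9)
      + (2 * D + (2 * k + 3) / (5 * K ^ 9)) * ((2 * k + 3) / (5 * K ^ 9))
      + 6 * (D + (2 * k + 3) / (5 * K ^ 9) + 3 / K ^ 9) / K ^ 9 ≤ S)
    (hL : 242 * log K / K ^ 10 + 37 * (D + (2 * k + 3) / (5 * K ^ 9) + 4 / K ^ 9) / K ^ 9 ≤ L)
    (hNP : P₁ + (3 * (k * π / ((25 / 16 - 1 / 10 ^ 6) * K ^ 10 - 1) + 1 / K ^ 19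
      + 310 * log K / K ^ 9) / 10 + 6 / K ^ 9) + ((N : ℝ) - 1) * S ≤ 1 / 50) :
    ∀ n : ℕ, 1 ≤ n → n ≤ N → ∃ r θ : ℝ, r₀ + ((n : ℝ) - 1) ≤ r ∧ X r 1 = θ * ε ∧
      5 / 4 + ((N : ℝ) - n) * L ≤ θ ∧ θ ≤ 29 / 20 ∧
      X r 2 = ρ ^ 2 / K ^ 9 ∧
      X r 3 ^ 2 + X r 4 ^ 2 ≤ P₁ + ((n : ℝ) - 1) * S ∧
      A₀ + ((n : ℝ) - 1) / K ^ 9 ≤ X r 4 ∧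
      |X r 3| ≤ D₀ + ((n : ℝ) - 1) * ((61 / 12 * k + 2 / 3) / K ^ 10 + 3 / K ^ 9) ∧
      |X r 3| ≤ D₀ + (1 + 10 / 9 * K ^ 8 / n) * ((61 / 12 * k + 2 / 3) / K ^ 10 + 3 / K ^ 9) := by
  obtain ⟨hk1, -, -, hδ0, -, -⟩ := rung_numerics hK hε hρ hlo k hk
  have hK0 : (0 : ℝ) < K := by linarith
  have hK8 : (0 : ℝ) < K ^ 8 := by positivity
  have hK9 : (0 : ℝ) < K ^ 9 := by positivity
  have hK10 : (0 : ℝ) < K ^ 10 := by positivity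
  have hk0 : (0 : ℝ) ≤ k := Nat.cast_nonneg k
  have hlogK : 0 ≤ log K := Real.log_nonneg (by linarith)
  have h310 : (0 : ℝ) ≤ 310 * log K / K ^ 9 := div_nonneg (by positivity) hK9.le
  have h6 : (0 : ℝ) ≤ 6 / K ^ 9 := by positivity
  have h3 : (0 : ℝ) ≤ 3 / K ^ 9 := by positivity
  have hD0 : 0 ≤ D₀ := le_trans (abs_nonneg _) hD₀
  obtain ⟨s, hs_def⟩ : ∃ s : ℝ, s = 3 * (k * π / ((25 / 16 - 1 / 10 ^ 6) * K ^ 10 - 1)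
      + 1 / K ^ 19 + 310 * log K / K ^ 9) / 10 + 6 / K ^ 9 := ⟨_, rfl⟩
  have hs0 : 0 ≤ s := by rw [hs_def]; linarith only [hδ0, h310, h6]
  obtain ⟨J, hJ_def⟩ : ∃ J : ℝ, J = (61 / 12 * k + 2 / 3) / K ^ 10 + 3 / K ^ 9 := ⟨_, rfl⟩
  have hJ0 : 0 ≤ J := by rw [hJ_def]; positivity
  obtain ⟨ι, hι_def⟩ : ∃ ι : ℝ, ι = (2 * k + 3) / (5 * K ^ 9) := ⟨_, rfl⟩
  have hι0 : 0 ≤ ι := by rw [hι_def]; positivity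
  obtain ⟨hDnn, -, hS0⟩ := clock_slip_signs hK hk1 hD0 hD hU hS
  obtain ⟨-, hfine6, -, hl0⟩ := sharp_clock_signs hK hDnn
    (by positivity : (0 : ℝ) ≤ (2 * k + 3) / (5 * K ^ 9)) hL
  have hlogc : 0 ≤ 2 * log k + 520 * log K := by
    have : 0 ≤ log (k : ℝ) := Real.log_nonneg hk1
    linarith only [this, hlogK]
  simp only [← hs_def, ← hJ_def, ← hι_def] at hNP hD hS hL ⊢
  have hcold6 : 0 ≤ 6 * (D + ι + 3 / K ^ 9) / K ^ 9 :=
    div_nonneg (mul_nonneg (by norm_num) (by linarith only [hDnn, hι0, h3])) hK9.le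
  intro n hn
  induction n, hn using Nat.le_induction with
  | base =>
    intro _
    refine ⟨r₀, θ₀, by simp, hb₀, by simpa using hθ₀lo, hθ₀hi, hc₀, by simpa using hP₁,
      by simpa using hA₀, by simpa using hD₀, ?_⟩
    have : 0 ≤ (1 + 10 / 9 * K ^ 8) * J := mul_nonneg (by positivity) hJ0
    norm_num; linarith only [hD₀, this]
  | succ m hm ih =>
    intro hmN
    obtain ⟨r, θ, hr, hb, hθlo, hθhi, hc, hP, hA, hd1, hd2⟩ := ih (Nat.le_of_succ_le hmN)
    have hm1 : (1 : ℝ) ≤ m := by exact_mod_cast hm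
    have hmN' : (m : ℝ) + 1 ≤ N := by exact_mod_cast hmN
    have hNm : 0 ≤ ((N : ℝ) - m) * L := mul_nonneg (by linarith) hl0
    have hmq : 0 ≤ (m : ℝ) * L := mul_nonneg (by linarith) hl0
    have hr0 : 0 ≤ r := by linarith only [hr₀, hr, hm1]
    have hθ1 : 5 / 4 ≤ θ := by linarith only [hθlo, hNm]
    have hmS : ((m : ℝ) - 1) * S ≤ ((N : ℝ) - 1) * S - S := by
      have := mul_nonneg (sub_nonneg.2 hmN') hS0
      linarith only [this]
    have hP50 : X r 3 ^ 2 + X r 4 ^ 2 + s ≤ 1 / 50 := by linarith only [hP, hNP, hmS, hS0]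
    have hPr : X r 3 ^ 2 + X r 4 ^ 2 + 3 * (k * π / ((25 / 16 - 1 / 10 ^ 6) * K ^ 10 - 1)
        + 1 / K ^ 19 + 310 * log K / K ^ 9) / 10 + 6 / K ^ 9 ≤ 1 / 50 := by
      rw [hs_def] at hP50; linarith only [hP50]
    -- the pulse half (part 84 §246)
    obtain ⟨T', θ₁, hrT, -, -, -, hbT, hθ₁lo, hθ₁hi, hfloor, hcT, -, he0, hecr, hfl, hceil,
        hdT⟩ :=
      knob_pulse_half_clock hX h0 hC hK hε hεK hρ hlo hhi k hk hr0 hθ1 hθhi hb hc hPr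
    have hT'0 : 0 ≤ T' := by linarith only [hr0, hrT]
    have em1 : ((m : ℝ) - 1) + 1 = m := by ring
    -- the pulse P-slip on the ledgers (part 82 §239)
    have hdD : |X r 3| ≤ D :=
      (ledger_invariant_final hK0 hJ0 (by linarith) hd1 (by rw [em1]; exact hd2)).trans hD
    have ha0 : 0 ≤ X r 4 := le_trans (add_nonneg hA0 (div_nonneg (by linarith) hK9.le)) hA
    have haP : X r 4 ^ 2 ≤ 1 / 50 := by nlinarith only [hP50, hs0, sq_nonneg (X r 3)]
    have heT : K * X T' 4 ≤ 3 / 20 * K := by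
      have h2a : X r 4 ≤ 1415 / 10000 := by nlinarith only [haP, ha0]
      have : X T' 4 ≤ 3 / 20 := by linarith only [hecr, pulse_gain_crude hK, h2a]
      nlinarith only [this, hK0]
    obtain ⟨-, hι⟩ := iota_numerics hK hk0 (mul_nonneg hK0.le he0) heT
    rw [← hι_def] at hι
    have hdT' : |X T' 3| ≤ |X r 3| + ι := by linarith only [hdT, hι]
    have hd2D : X r 3 ^ 2 ≤ D ^ 2 := by
      have := pow_le_pow_left₀ (abs_nonneg _) hdD 2
      rwa [sq_abs] at this
    have hUr : 7 / 2 + k ^ 2 / 3 + (2 * log k + 520 * log K) * X r 3 ^ 2 ≤ U := by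
      have := mul_le_mul_of_nonneg_left hd2D hlogc
      linarith only [this, hU]
    have haT' : X T' 4 ≤ X r 4 + U / K ^ 9 := by
      linarith only [hceil, div_le_div_of_nonneg_right hUr hK9.le]
    have haa' : X r 4 ≤ X T' 4 := by
      have : (0 : ℝ) < 1 / K ^ 9 := by positivity
      linarith only [hfl, this]
    have slip := pulse_pslip ha0 haP haT' haa' hdT' hdD hι0

    -- the exit budget `P(T') ≤ 1/50`, then the SHARP cold half (part 87 §255)
    have hPT : X T' 3 ^ 2 + X T' 4 ^ 2 ≤ 1 / 50 := by
      linarith only [slip, hS, hcold6, hP, hNP, hmS, hs0]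
    have hθ₁1 : 1249 / 1000 ≤ θ₁ := by linarith only [hθ₁lo, hθ1, hfine6]
    have hθ₁2 : θ₁ ≤ 3 / 2 := by linarith only [hθ₁hi, hθhi, hfine6]
    obtain ⟨tz, r', θ', ⟨htz1, -, htz2, hr'3, hcold, hc'⟩, ⟨hb', hθ'hi, hθ'lo, hpair⟩, -, hdr',
        hmono, -, -⟩ :=
      knob_cold_half_sharp hX h0 hK hε hεK hρ hhi hT'0 hθ₁1 hθ₁2 hbT hPT hfloor hcT he0
    -- the pair slip of the rung: pulse (§239) + the sharp cold law at dose level `≤ D + ι + 3/K⁹`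
    have hcold' : 6 * (|X T' 3| + 3 / K ^ 9) / K ^ 9 ≤ 6 * (D + ι + 3 / K ^ 9) / K ^ 9 :=
      div_le_div_of_nonneg_right (by linarith only [hdT', hdD]) hK9.le
    have hP's : X r' 3 ^ 2 + X r' 4 ^ 2 ≤ X r 3 ^ 2 + X r 4 ^ 2 + S := by
      have h1 := (abs_le.1 hpair).2
      linarith only [h1, hcold', slip, hS]
    -- the three ledger invariants (part 81 §238 verbatim)
    obtain ⟨x, hx⟩ : ∃ x : ℝ, x = K * X T' 4 := ⟨_, rfl⟩
    have hmK : (m : ℝ) / K ^ 9 ≤ X T' 4 := by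
      have e : ((m : ℝ) - 1) / K ^ 9 + 1 / K ^ 9 = (m : ℝ) / K ^ 9 := by ring
      linarith only [hA, hfl, hA0, e]
    have hxm : (m : ℝ) / K ^ 8 ≤ x := by
      have e : K * ((m : ℝ) / K ^ 9) = (m : ℝ) / K ^ 8 := by field_simp
      rw [hx, ← e]; exact mul_le_mul_of_nonneg_left hmK hK0.le
    have hx0 : 0 ≤ x := le_trans (by positivity) hxm
    have hq0 : 0 ≤ exp (-(9 / 4 * x)) := (exp_pos _).le
    have hq1 : exp (-(9 / 4 * x)) ≤ 1 := by rw [Real.exp_le_one_iff]; linarith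
    have hinj : exp (-(9 / 4 * x)) * (5 * k + (k / 2 + 4) * x) ≤ 61 / 12 * k + 2 / 3 := by
      have f1 := mul_le_of_le_one_left (by positivity : (0 : ℝ) ≤ 5 * k) hq1
      have f2 := mul_le_mul_of_nonneg_left (injection_numerics x)
        (by positivity : (0 : ℝ) ≤ k / 2 + 4)
      linarith [f1, f2]
    have hinj' : exp (-(9 / 4 * x)) * ((5 * k + (k / 2 + 4) * x) / K ^ 10)
        ≤ (61 / 12 * k + 2 / 3) / K ^ 10 := by
      rw [← mul_div_assoc]; exact div_le_div_of_nonneg_right hinj hK10.le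
    rw [← hx] at hdT hdr'
    have hprod := mul_le_mul_of_nonneg_right hdT hq0
    have hrec : |X r' 3| ≤ exp (-(9 / 4 * x)) * |X r 3| + J := by
      rw [hJ_def]; linarith [hdr', hprod, hinj']
    have hy : 9 / 4 * (((m : ℝ) - 1) + 1) / K ^ 8 ≤ 9 / 4 * x := by
      rw [em1, mul_div_assoc]; linarith only [hxm]
    obtain ⟨hd1', hd2'⟩ := ledger_invariant_step hK0 hJ0 hD0 (abs_nonneg _) (by linarith) hy
      hd1 (by rw [em1]; exact hd2) hrec
    have em : ((m : ℝ) - 1) + 2 = (m : ℝ) + 1 := by ring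
    rw [em] at hd2'

    refine ⟨r', θ', ?_, hb', ?_, by linarith only [hθ'hi], hc', ?_, ?_, ?_, ?_⟩
    · push_cast; linarith only [hr, hrT, htz1, htz2]
    · push_cast
      rcases hθ'lo with h | h
      · -- the sharp debt: `37(|d(T')| + 4/K⁹)/K⁹ ≤ 37(D + ι + 4/K⁹)/K⁹ ≤ L - 242 log K/K¹⁰`
        have h37 : 37 * (|X T' 3| + 4 / K ^ 9) / K ^ 9 ≤ 37 * (D + ι + 4 / K ^ 9) / K ^ 9 :=
          div_le_div_of_nonneg_right (by linarith only [hdT', hdD]) hK9.le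
        linarith only [hθlo, h, hθ₁lo, hL, h37]
      · linarith only [hNθ, h, hmq]
    · push_cast; linarith only [hP, hP's]
    · have e' : (((m + 1 : ℕ) : ℝ) - 1) / K ^ 9 = ((m : ℝ) - 1) / K ^ 9 + 1 / K ^ 9 := by
        push_cast; ring
      have hTr' : T' ≤ r' := by linarith only [htz1, htz2]
      linarith only [hA, hfl, hmono, e']
    · push_cast; linarith only [hd1']
    · push_cast; exact hd2'

/-- §257 **THE SHARP LADDER, READ OUT**: under §257 `knob_ladder_climb_sharp`'s hypotheses, at
every rung `1 ≤ n ≤ N` the ignition `rₙ ≥ r₀ + (n - 1)` is in normal form with `5/4 ≤ θₙ ≤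
29/20` and the pair is pinned from both sides, uniformly in `n`: `P(rₙ) ≤ P₁ + (n - 1)·S ≤
1/50`, `A₀ + (n - 1)/K⁹ ≤ ã(rₙ) ≤ 0.1415`, `|d(rₙ)| ≤ D`. [derived: this file §257, part 81
§237] -/
theorem knob_ladder_sharp
    (hX : ∀ t, HasDerivAt X (RotorKnob.rotorCircuit K (K ^ 10) ε ρ (X t)) t)
    (h0 : X 0 = delayInit) (hC : ∀ t, HasDerivAt C (X t 2) t) (hK : 16 ≤ K)
    (hε : 0 < ε) (hεK : ε ^ 2 ≤ 1 / (6 * K ^ 20)) (hρ : 0 < ρ)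
    (hlo : 200 * ε / K ^ 20 ≤ ρ ^ 2) (hhi : K ^ 10 * ρ ^ 2 ≤ 2 * ε) (k : ℕ)
    (hk : ε = k * K ^ 10 * ρ ^ 2) {r₀ θ₀ P₁ A₀ D₀ D U S L : ℝ} {N : ℕ} (hr₀ : 0 ≤ r₀)
    (hb₀ : X r₀ 1 = θ₀ * ε) (hc₀ : X r₀ 2 = ρ ^ 2 / K ^ 9) (hP₁ : X r₀ 3 ^ 2 + X r₀ 4 ^ 2 ≤ P₁)
    (hθ₀lo : 5 / 4 + ((N : ℝ) - 1) * L ≤ θ₀)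
    (hθ₀hi : θ₀ ≤ 29 / 20)
    (hNθ : ((N : ℝ) - 1) * L ≤ 14999 / 100000)
    (hA0 : 0 ≤ A₀) (hA₀ : A₀ ≤ X r₀ 4) (hD₀ : |X r₀ 3| ≤ D₀)
    (hD : D₀ + (1 + 10 / 9 * K ^ 4) * ((61 / 12 * k + 2 / 3) / K ^ 10 + 3 / K ^ 9) ≤ D)
    (hU : 7 / 2 + k ^ 2 / 3 + (2 * log k + 520 * log K) * D ^ 2 ≤ U)
    (hS : (2829 / 10000 + U / K ^ 9) * (U / K ^ 9)
      + (2 * D + (2 * k + 3) / (5 * K ^ 9)) * ((2 * k + 3) / (5 * K ^ 9))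
      + 6 * (D + (2 * k + 3) / (5 * K ^ 9) + 3 / K ^ 9) / K ^ 9 ≤ S)
    (hL : 242 * log K / K ^ 10 + 37 * (D + (2 * k + 3) / (5 * K ^ 9) + 4 / K ^ 9) / K ^ 9 ≤ L)
    (hNP : P₁ + (3 * (k * π / ((25 / 16 - 1 / 10 ^ 6) * K ^ 10 - 1) + 1 / K ^ 19
      + 310 * log K / K ^ 9) / 10 + 6 / K ^ 9) + ((N : ℝ) - 1) * S ≤ 1 / 50) :
    ∀ n : ℕ, 1 ≤ n → n ≤ N → ∃ r θ : ℝ, r₀ + ((n : ℝ) - 1) ≤ r ∧ X r 1 = θ * ε ∧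
      5 / 4 ≤ θ ∧ θ ≤ 29 / 20 ∧ X r 2 = ρ ^ 2 / K ^ 9 ∧
      X r 3 ^ 2 + X r 4 ^ 2 ≤ P₁ + ((n : ℝ) - 1) * S ∧ X r 3 ^ 2 + X r 4 ^ 2 ≤ 1 / 50 ∧
      A₀ + ((n : ℝ) - 1) / K ^ 9 ≤ X r 4 ∧ X r 4 ≤ 1415 / 10000 ∧ |X r 3| ≤ D := by
  intro n hn hnN
  obtain ⟨r, θ, hr, hb, hθlo, hθhi, hc, hP, hA, hd1, hd2⟩ := knob_ladder_climb_sharp hX h0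
    hC hK hε hεK hρ hlo hhi k hk hr₀ hb₀ hc₀ hP₁ hθ₀lo hθ₀hi hNθ hA0 hA₀ hD₀ hD hU hS hL hNP n
    hn hnN
  obtain ⟨hk1, -, -, hδ0, -, -⟩ := rung_numerics hK hε hρ hlo k hk
  have hK0 : (0 : ℝ) < K := by linarith
  have hK9 : (0 : ℝ) < K ^ 9 := by positivity
  have hn1 : (1 : ℝ) ≤ n := by exact_mod_cast hn
  have hnN' : (n : ℝ) ≤ N := by exact_mod_cast hnN
  obtain ⟨hDnn, -, hS0⟩ := clock_slip_signs hK hk1 ((abs_nonneg _).trans hD₀) hD hU hS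
  obtain ⟨-, -, -, hl0⟩ := sharp_clock_signs hK hDnn
    (by positivity : (0 : ℝ) ≤ (2 * k + 3) / (5 * K ^ 9)) hL
  have h310 : (0 : ℝ) ≤ 310 * log K / K ^ 9 :=
    div_nonneg (mul_nonneg (by norm_num) (Real.log_nonneg (by linarith))) hK9.le
  have hθ : 5 / 4 ≤ θ := by
    have := mul_nonneg (sub_nonneg.2 hnN') hl0
    linarith only [hθlo, this]
  have hP50 : X r 3 ^ 2 + X r 4 ^ 2 ≤ 1 / 50 := by
    have h1 : ((n : ℝ) - 1) * S ≤ ((N : ℝ) - 1) * S :=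
      mul_le_mul_of_nonneg_right (by linarith only [hnN']) hS0
    have h2 : (0 : ℝ) ≤ 6 / K ^ 9 := by positivity
    linarith only [hP, h1, hNP, hδ0, h310, h2]
  have ha0 : 0 ≤ X r 4 := le_trans (add_nonneg hA0 (div_nonneg (by linarith) hK9.le)) hA
  have ha : X r 4 ≤ 1415 / 10000 := by nlinarith only [hP50, ha0, sq_nonneg (X r 3)]
  have e : ((n : ℝ) - 1) + 1 = n := by ring
  have hd : |X r 3| ≤ D :=
    (ledger_invariant_final hK0 (by positivity) (by linarith) hd1 (by rw [e]; exact hd2)).trans hD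
  exact ⟨r, θ, hr, hb, hθ, hθhi, hc, hP, hP50, hA, ha, hd⟩

end Summit.NavierStokesRegularity.FluidComputer.GateBudget

end
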